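import Summits.HodgeConjecture.HodgeConjecture.Theorems.PadicSemiregularLiftFormalLiftingFromClassLiftingTowerCocycles
import Summits.HodgeConjecture.HodgeConjecture.Theorems.PadicSemiregularLiftFormalLiftingFromClassLiftingTruncatedExpLog

/-!
# `FormalLiftingFromClassLifting` (stmt-HodgeConjecture-13825) · line `IdeatorFiveSketch` ·
# the logarithm side of (2_Pic): ring identities of the power-map logarithm on the `p`-adic tower

Support file for stub S4 `stub_picKernelLift` ((2_Pic)) of the weight-one-first skeleton (lead
prover-line-stmt-HodgeConjecture-13825-c1-0). `Λ = (Λ_M)_M` is an abstract *logarithm package*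
(`exists_log_package`, extracted from the landed S3 `stub_truncatedExpLog`): natural polynomial maps
`Λ_M : R → R` with `Λ_M(x ⊕ y) ≡ Λ_M x + Λ_M y`, injective and surjective modulo `p^M`, and
`Λ_{M+1} ≡ Λ_M (mod p^{M+1})`, where `x ⊕ y = x + y + pxy` is the group law of `1 + p𝒪`. We prove the
three ring-theoretic steps of (2_Pic) on sections of `𝒳` pushed to the thickenings `X_n`:
the logarithm of a multiplicative cocycle `≡ 1 (mod p)` on `X_{n+1}` is an additive cocycle modulo
`pⁿ` (`log_cocycle`); a `Λ_{n+1}`-preimage of an additive cocycle modulo `p^{n+1}` exponentiates to a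
multiplicative datum on `X_{n+2}` (`datum_of_log_lift`, registered); and the units `1 + pζ` comparing
two data on `X_{n+1}` (`rel_of_log_lift`). Everything is proved; no definitions.
-/

set_option linter.dupNamespace false

namespace Summit.HodgeConjecture.HodgeConjecture.Theorems.FormalLiftingFromClassLifting.WeightOne

open CategoryTheory AlgebraicGeometry Limits Opposite TopologicalSpace
open Literature.AlgebraicGeometry Literature.AlgebraicGeometry.Motives
open Literature.AlgebraicGeometry.Motives.WittScheme
open Literature.AlgebraicGeometry.Modules (CechPic UnitCocycle)
open Summit.HodgeConjecture.HodgeConjecture.Theorems.FormalVectorBundlesAlgebraize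
  (thickeningι_cutOut mul_p_injective_sections mul_p_pow_injective_sections)

noncomputable section

/-! ## The logarithm package -/

/-- **The logarithm package** extracted from the landed S3 `stub_truncatedExpLog` (the power-map
logarithm as an integer polynomial): natural maps `Λ_M : R → R`, homomorphic, injective and surjective
modulo `p^M`, with `Λ_{M+1} ≡ Λ_M (mod p^{M+1})`. -/
theorem exists_log_package (p : ℕ) (hp : p.Prime) (hp2 : p ≠ 2) :
    ∃ Λ : ∀ (R : Type) [CommRing R], ℕ → R → R,
      (∀ (R S : Type) [CommRing R] [CommRing S] (f : R →+* S) (M : ℕ) (x : R),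
        f (Λ R M x) = Λ S M (f x)) ∧
      (∀ (R : Type) [CommRing R] (M : ℕ), Λ R M 0 = 0) ∧
      ∀ (R : Type) [CommRing R] (M : ℕ),
        (∀ x y : R, ∃ w : R, Λ R M (x + y + p * x * y) = Λ R M x + Λ R M y + (p : R) ^ M * w) ∧
        (∀ x x' : R, (∃ w : R, Λ R M x' = Λ R M x + (p : R) ^ M * w) →
          ∃ w : R, x' = x + (p : R) ^ M * w) ∧
        (∀ y : R, ∃ x w : R, Λ R M x = y + (p : R) ^ M * w) ∧
        (∀ x : R, ∃ w : R, Λ R (M + 1) x = Λ R M x + (p : R) ^ (M + 1) * w) ∧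
        (∀ x w : R, ∃ w' : R, Λ R M (x + (p : R) ^ M * w) = Λ R M x + (p : R) ^ M * w') := by
  obtain ⟨d, γ, h⟩ := stub_truncatedExpLog p hp hp2
  refine ⟨fun R _ M x => ∑ j ∈ Finset.range (d M), (γ M j : R) * x ^ (j + 1), ?_, ?_, ?_⟩
  · intro R S _ _ f M x
    simp only [map_sum, map_mul, map_pow, map_intCast]
  · intro R _ M
    simp
  · intro R _ M
    obtain ⟨-, hb, hc, hd, he, hf⟩ := h R M
    exact ⟨hb, hc, hd, he, hf⟩

section Ring

variable {p : ℕ} [Fact p.Prime] {k : Type} [Field k] (𝒳 : SchemeOver (WittVector p k))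

/-- Naturality of the restriction to `X_n` on sections of `𝒳`. -/
theorem thickeningι_app_res (n : ℕ) {U U' : 𝒳.left.Opens} (i : U' ≤ U) (a : Γ(𝒳.left, U)) :
    (thickeningι 𝒳 n).app U' (𝒳.left.presheaf.map (homOfLE i).op a) =
      (thickening 𝒳 n).left.presheaf.map
        (homOfLE (show (thickeningι 𝒳 n) ⁻¹ᵁ U' ≤ (thickeningι 𝒳 n) ⁻¹ᵁ U from fun _ hq => i hq)).op
        ((thickeningι 𝒳 n).app U a) := by
  rw [← CategoryTheory.comp_apply, ← CategoryTheory.comp_apply, (thickeningι 𝒳 n).naturality (homOfLE i).op]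
  rfl

/-- Restriction of a restriction on `X_n`. -/
theorem thickening_res_res (n : ℕ) {U V V' : (thickening 𝒳 n).left.Opens} (i : V ≤ U) (j : V' ≤ V)
    (a : Γ((thickening 𝒳 n).left, U)) :
    (thickening 𝒳 n).left.presheaf.map (homOfLE j).op
      ((thickening 𝒳 n).left.presheaf.map (homOfLE i).op a) =
    (thickening 𝒳 n).left.presheaf.map (homOfLE (j.trans i)).op a := by
  rw [← CategoryTheory.comp_apply, ← CategoryTheory.Functor.map_comp]
  rfl

/-- Restriction along an inequality of equal opens is injective on sections of `X_n`. -/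
theorem thickening_res_injective_of_ge (n : ℕ) {U V : (thickening 𝒳 n).left.Opens} (i : V ≤ U)
    (j : U ≤ V) (a : Γ((thickening 𝒳 n).left, U))
    (ha : (thickening 𝒳 n).left.presheaf.map (homOfLE i).op a = 0) : a = 0 := by
  have h := congrArg ((thickening 𝒳 n).left.presheaf.map (homOfLE j).op) ha
  rw [map_zero, thickening_res_res, show homOfLE (j.trans i) = 𝟙 U from Subsingleton.elim _ _,
    op_id, CategoryTheory.Functor.map_id, CategoryTheory.id_apply] at h
  exact h

/-- **Step 2 of S4: the logarithm of a multiplicative cocycle `≡ 1 (mod p)` on `X_{n+1}` is an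
additive cocycle modulo `pⁿ`** (on an affine open of `𝒳` flat over `W`). [folklore] -/
theorem log_cocycle [CharP k p] [Flat 𝒳.hom] (n : ℕ) (Λ : ∀ (R : Type) [CommRing R], ℕ → R → R)
    (hΛ : ∀ (R : Type) [CommRing R] (M : ℕ),
      (∀ x y : R, ∃ w : R, Λ R M (x + y + p * x * y) = Λ R M x + Λ R M y + (p : R) ^ M * w) ∧
      (∀ x x' : R, (∃ w : R, Λ R M x' = Λ R M x + (p : R) ^ M * w) →
        ∃ w : R, x' = x + (p : R) ^ M * w) ∧
      (∀ y : R, ∃ x w : R, Λ R M x = y + (p : R) ^ M * w) ∧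
      (∀ x : R, ∃ w : R, Λ R (M + 1) x = Λ R M x + (p : R) ^ (M + 1) * w) ∧
      (∀ x w : R, ∃ w' : R, Λ R M (x + (p : R) ^ M * w) = Λ R M x + (p : R) ^ M * w'))
    {U : 𝒳.left.Opens} (hU : IsAffineOpen U) (a b c : Γ(𝒳.left, U))
    (h1 : (thickeningι 𝒳 (n + 1)).app U
      ((1 + (p : Γ(𝒳.left, U)) * a) * (1 + (p : Γ(𝒳.left, U)) * b) -
        (1 + (p : Γ(𝒳.left, U)) * c)) = 0) :
    ∃ E : Γ(𝒳.left, U), Λ _ n b - Λ _ n c + Λ _ n a = (p : Γ(𝒳.left, U)) ^ n * E := by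
  obtain ⟨D, hD⟩ := exists_eq_pow_mul_of_app_thickeningι_eq_zero 𝒳 (n + 1) hU _ h1
  -- cancel one `p`: `a ⊕ b = c + pⁿ D`
  have h2 : c = (a + b + (p : Γ(𝒳.left, U)) * a * b) + (p : Γ(𝒳.left, U)) ^ n * (-D) := by
    have h3 : (p : Γ(𝒳.left, U)) *
        ((a + b + (p : Γ(𝒳.left, U)) * a * b) - c - (p : Γ(𝒳.left, U)) ^ n * D) = 0 := by
      linear_combination hD
    have h4 := mul_p_injective_sections 𝒳 U _ h3
    linear_combination -h4
  obtain ⟨w₁, hw₁⟩ := (hΛ _ n).1 a b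
  obtain ⟨w₂, hw₂⟩ := (hΛ _ n).2.2.2.2 (a + b + (p : Γ(𝒳.left, U)) * a * b) (-D)
  refine ⟨-(w₂ + w₁), ?_⟩
  rw [h2, hw₂, hw₁]
  ring

set_option maxHeartbeats 800000 in
-- ring identities on double intersections, pushed to `X_{n+1}`
/-- **Step 5 of S4: the units relating the two data on `X_{n+1}`.** With `Λ_n(w) ≡ B̂ + Z_y − Z_x`
(mod `pⁿ`), `Λ_{n+1}(x̂) ≡ B̂` (mod `p^{n+1}`) and `Λ_n(ζ) ≡ −Z` (mod `pⁿ`), the units `1 + p ζ`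
conjugate `1 + p w` into `1 + p x̂` on `X_{n+1}`. [folklore] -/
theorem rel_of_log_lift (n : ℕ) (Λ : ∀ (R : Type) [CommRing R], ℕ → R → R)
    (hΛnat : ∀ (R S : Type) [CommRing R] [CommRing S] (f : R →+* S) (M : ℕ) (x : R),
      f (Λ R M x) = Λ S M (f x))
    (hΛ : ∀ (R : Type) [CommRing R] (M : ℕ),
      (∀ x y : R, ∃ w : R, Λ R M (x + y + p * x * y) = Λ R M x + Λ R M y + (p : R) ^ M * w) ∧
      (∀ x x' : R, (∃ w : R, Λ R M x' = Λ R M x + (p : R) ^ M * w) →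
        ∃ w : R, x' = x + (p : R) ^ M * w) ∧
      (∀ y : R, ∃ x w : R, Λ R M x = y + (p : R) ^ M * w) ∧
      (∀ x : R, ∃ w : R, Λ R (M + 1) x = Λ R M x + (p : R) ^ (M + 1) * w) ∧
      (∀ x w : R, ∃ w' : R, Λ R M (x + (p : R) ^ M * w) = Λ R M x + (p : R) ^ M * w'))
    {U Vx Vy : 𝒳.left.Opens} (hV : Vx ⊓ Vy ≤ U) (w : Γ(𝒳.left, U))
    (B X jx e : Γ(𝒳.left, Vx ⊓ Vy)) (Zx ζx jzx : Γ(𝒳.left, Vx)) (Zy ζy jzy : Γ(𝒳.left, Vy))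
    (he : 𝒳.left.presheaf.map (homOfLE hV).op (Λ _ n w) - B -
        𝒳.left.presheaf.map (homOfLE inf_le_right).op Zy +
        𝒳.left.presheaf.map (homOfLE inf_le_left).op Zx = (p : Γ(𝒳.left, Vx ⊓ Vy)) ^ n * e)
    (hX : Λ _ (n + 1) X = B + (p : Γ(𝒳.left, Vx ⊓ Vy)) ^ (n + 1) * jx)
    (hζx : Λ _ n ζx = -Zx + (p : Γ(𝒳.left, Vx)) ^ n * jzx)
    (hζy : Λ _ n ζy = -Zy + (p : Γ(𝒳.left, Vy)) ^ n * jzy) :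
    (thickeningι 𝒳 (n + 1)).app (Vx ⊓ Vy)
        (𝒳.left.presheaf.map (homOfLE hV).op (1 + (p : Γ(𝒳.left, U)) * w) *
          𝒳.left.presheaf.map (homOfLE inf_le_right).op (1 + (p : Γ(𝒳.left, Vy)) * ζy)) =
      (thickeningι 𝒳 (n + 1)).app (Vx ⊓ Vy)
        (𝒳.left.presheaf.map (homOfLE inf_le_left).op (1 + (p : Γ(𝒳.left, Vx)) * ζx) *
          (1 + (p : Γ(𝒳.left, Vx ⊓ Vy)) * X)) := by
  set ρ := 𝒳.left.presheaf.map (homOfLE hV).op with hρ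
  set rl := 𝒳.left.presheaf.map (homOfLE (inf_le_left : Vx ⊓ Vy ≤ Vx)).op with hrl
  set rr := 𝒳.left.presheaf.map (homOfLE (inf_le_right : Vx ⊓ Vy ≤ Vy)).op with hrr
  have hω : Λ _ n (ρ w) = ρ (Λ _ n w) := (hΛnat _ _ _ n w).symm
  have hζy' : Λ _ n (rr ζy) = -rr Zy + (p : Γ(𝒳.left, Vx ⊓ Vy)) ^ n * rr jzy := by
    rw [← hΛnat, hζy, map_add, map_neg, map_mul, map_pow, map_natCast]
  have hζx' : Λ _ n (rl ζx) = -rl Zx + (p : Γ(𝒳.left, Vx ⊓ Vy)) ^ n * rl jzx := by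
    rw [← hΛnat, hζx, map_add, map_neg, map_mul, map_pow, map_natCast]
  obtain ⟨w₁, hw₁⟩ := (hΛ _ n).1 (ρ w) (rr ζy)
  obtain ⟨w₂, hw₂⟩ := (hΛ _ n).1 (rl ζx) X
  obtain ⟨w₅, hw₅⟩ := (hΛ _ n).2.2.2.1 X
  obtain ⟨v, hv⟩ := (hΛ _ n).2.1 (rl ζx + X + p * rl ζx * X) (ρ w + rr ζy + p * ρ w * rr ζy)
    ⟨e + rr jzy + w₁ - rl jzx - p * jx + p * w₅ - w₂, by
      linear_combination hw₁ + hω + hζy' - hw₂ - hζx' + hw₅ - hX + he⟩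
  have hunits : ρ (1 + (p : Γ(𝒳.left, U)) * w) * rr (1 + (p : Γ(𝒳.left, Vy)) * ζy) =
      rl (1 + (p : Γ(𝒳.left, Vx)) * ζx) * (1 + (p : Γ(𝒳.left, Vx ⊓ Vy)) * X) + (p : Γ(𝒳.left, Vx ⊓ Vy)) ^ (n + 1) * v := by
    simp only [map_add, map_mul, map_one, map_natCast]
    linear_combination (p : Γ(𝒳.left, Vx ⊓ Vy)) * hv
  rw [hunits, map_add, app_thickeningι_pow_mul, add_zero]
end Ring

section Registered

set_option maxHeartbeats 800000 in
-- ring identities on triple intersections, pushed to `X_{n+2}`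
/-- **Step 4 of S4: the lifted datum.** If `Λ_{n+1}(x̂) ≡ B̂ (mod p^{n+1})` where `B̂` is an additive
cocycle modulo `p^{n+1}`, then `Ĝ := 1 + p x̂` is a multiplicative datum on `X_{n+2}`
(cocycle identity and normalisation on the diagonal). [folklore] -/
theorem datum_of_log_lift :
    ∀ (p : ℕ) [Fact p.Prime] (k : Type) [Field k] (𝒳 : SchemeOver (WittVector p k))
    (n : ℕ) (Λ : ∀ (R : Type) [CommRing R], ℕ → R → R)
    (hΛnat : ∀ (R S : Type) [CommRing R] [CommRing S] (f : R →+* S) (M : ℕ) (x : R),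
      f (Λ R M x) = Λ S M (f x))
    (hΛ : ∀ (R : Type) [CommRing R] (M : ℕ),
      (∀ x y : R, ∃ w : R, Λ R M (x + y + p * x * y) = Λ R M x + Λ R M y + (p : R) ^ M * w) ∧
      (∀ x x' : R, (∃ w : R, Λ R M x' = Λ R M x + (p : R) ^ M * w) →
        ∃ w : R, x' = x + (p : R) ^ M * w) ∧
      (∀ y : R, ∃ x w : R, Λ R M x = y + (p : R) ^ M * w) ∧
      (∀ x : R, ∃ w : R, Λ R (M + 1) x = Λ R M x + (p : R) ^ (M + 1) * w) ∧
      (∀ x w : R, ∃ w' : R, Λ R M (x + (p : R) ^ M * w) = Λ R M x + (p : R) ^ M * w'))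
    (W' : 𝒳.left → 𝒳.left.Opens) (B xh jx Gh : ∀ x y : 𝒳.left, Γ(𝒳.left, W' x ⊓ W' y))
    (hBcoc : ∀ x y z : 𝒳.left, ∃ e : Γ(𝒳.left, W' x ⊓ W' y ⊓ W' z),
      𝒳.left.presheaf.map
          (homOfLE (le_inf (inf_le_left.trans inf_le_right) inf_le_right)).op (B y z) -
        𝒳.left.presheaf.map
          (homOfLE (le_inf (inf_le_left.trans inf_le_left) inf_le_right)).op (B x z) +
        𝒳.left.presheaf.map (homOfLE inf_le_left).op (B x y) =
      (p : Γ(𝒳.left, W' x ⊓ W' y ⊓ W' z)) ^ (n + 1) * e)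
    (hxh : ∀ x y, Λ _ (n + 1) (xh x y) = B x y + (p : Γ(𝒳.left, W' x ⊓ W' y)) ^ (n + 1) * jx x y)
    (hGh : ∀ x y, Gh x y = 1 + (p : Γ(𝒳.left, W' x ⊓ W' y)) * xh x y),
    (∀ x y z : 𝒳.left,
      (thickeningι 𝒳 (n + 2)).app (W' x ⊓ W' y ⊓ W' z)
        (𝒳.left.presheaf.map (homOfLE inf_le_left).op (Gh x y) *
          𝒳.left.presheaf.map
            (homOfLE (le_inf (inf_le_left.trans inf_le_right) inf_le_right)).op (Gh y z)) =
      (thickeningι 𝒳 (n + 2)).app (W' x ⊓ W' y ⊓ W' z)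
        (𝒳.left.presheaf.map
          (homOfLE (le_inf (inf_le_left.trans inf_le_left) inf_le_right)).op (Gh x z))) ∧
    (∀ x : 𝒳.left, (thickeningι 𝒳 (n + 2)).app (W' x ⊓ W' x) (Gh x x) = 1) := by
  intro p _ k _ 𝒳 n Λ hΛnat hΛ W' B xh jx Gh hBcoc hxh hGh
  have hmul : ∀ x y z : 𝒳.left,
      (thickeningι 𝒳 (n + 2)).app (W' x ⊓ W' y ⊓ W' z)
        (𝒳.left.presheaf.map (homOfLE inf_le_left).op (Gh x y) *
          𝒳.left.presheaf.map
            (homOfLE (le_inf (inf_le_left.trans inf_le_right) inf_le_right)).op (Gh y z)) =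
      (thickeningι 𝒳 (n + 2)).app (W' x ⊓ W' y ⊓ W' z)
        (𝒳.left.presheaf.map
          (homOfLE (le_inf (inf_le_left.trans inf_le_left) inf_le_right)).op (Gh x z)) := by
    intro x y z
    have hBxyz := hBcoc x y z
    set ρ₃ := 𝒳.left.presheaf.map (homOfLE (inf_le_left : W' x ⊓ W' y ⊓ W' z ≤ W' x ⊓ W' y)).op
      with hρ₃
    set ρ₁ := 𝒳.left.presheaf.map (homOfLE (le_inf (inf_le_left.trans inf_le_right) inf_le_right :
      W' x ⊓ W' y ⊓ W' z ≤ W' y ⊓ W' z)).op with hρ₁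
    set ρ₂ := 𝒳.left.presheaf.map (homOfLE (le_inf (inf_le_left.trans inf_le_left) inf_le_right :
      W' x ⊓ W' y ⊓ W' z ≤ W' x ⊓ W' z)).op with hρ₂
    obtain ⟨e, he⟩ := hBxyz
    have ha : Λ _ (n + 1) (ρ₃ (xh x y)) =
        ρ₃ (B x y) + (p : Γ(𝒳.left, W' x ⊓ W' y ⊓ W' z)) ^ (n + 1) * ρ₃ (jx x y) := by
      rw [← hΛnat, hxh, map_add, map_mul, map_pow, map_natCast]
    have hb : Λ _ (n + 1) (ρ₁ (xh y z)) =
        ρ₁ (B y z) + (p : Γ(𝒳.left, W' x ⊓ W' y ⊓ W' z)) ^ (n + 1) * ρ₁ (jx y z) := by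
      rw [← hΛnat, hxh, map_add, map_mul, map_pow, map_natCast]
    have hc : Λ _ (n + 1) (ρ₂ (xh x z)) =
        ρ₂ (B x z) + (p : Γ(𝒳.left, W' x ⊓ W' y ⊓ W' z)) ^ (n + 1) * ρ₂ (jx x z) := by
      rw [← hΛnat, hxh, map_add, map_mul, map_pow, map_natCast]
    obtain ⟨w₁, hw₁⟩ := (hΛ _ (n + 1)).1 (ρ₃ (xh x y)) (ρ₁ (xh y z))
    obtain ⟨w₃, hw₃⟩ := (hΛ _ (n + 1)).2.1
      (ρ₃ (xh x y) + ρ₁ (xh y z) + p * ρ₃ (xh x y) * ρ₁ (xh y z)) (ρ₂ (xh x z))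
      ⟨ρ₂ (jx x z) - e - ρ₃ (jx x y) - ρ₁ (jx y z) - w₁, by
        linear_combination hc - hw₁ - ha - hb - he⟩
    have hGG : ρ₃ (Gh x y) * ρ₁ (Gh y z) =
        ρ₂ (Gh x z) + (p : Γ(𝒳.left, W' x ⊓ W' y ⊓ W' z)) ^ (n + 2) * (-w₃) := by
      rw [hGh x y, hGh y z, hGh x z]
      simp only [map_add, map_mul, map_one, map_natCast]
      linear_combination (-(p : Γ(𝒳.left, W' x ⊓ W' y ⊓ W' z))) * hw₃
    rw [hGG, map_add, app_thickeningι_pow_mul, add_zero]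
  refine ⟨hmul, fun x => ?_⟩
  have hu : IsUnit ((thickeningι 𝒳 (n + 2)).app (W' x ⊓ W' x) (Gh x x)) := by
    rw [hGh, map_add, map_one, map_mul, map_natCast]
    exact isUnit_one_add_p_mul 𝒳 (n + 2) _
  have h := hmul x x x
  simp only [map_mul, thickeningι_app_res] at h
  have i3 : (thickeningι 𝒳 (n + 2)) ⁻¹ᵁ (W' x ⊓ W' x ⊓ W' x) ≤ (thickeningι 𝒳 (n + 2)) ⁻¹ᵁ (W' x ⊓ W' x) :=
    fun _ hq => (inf_le_left : W' x ⊓ W' x ⊓ W' x ≤ W' x ⊓ W' x) hq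
  have j3 : (thickeningι 𝒳 (n + 2)) ⁻¹ᵁ (W' x ⊓ W' x) ≤ (thickeningι 𝒳 (n + 2)) ⁻¹ᵁ (W' x ⊓ W' x ⊓ W' x) :=
    fun _ hq => (le_inf le_rfl inf_le_left : W' x ⊓ W' x ≤ W' x ⊓ W' x ⊓ W' x) hq
  have h' : (thickening 𝒳 (n + 2)).left.presheaf.map (homOfLE i3).op
        ((thickeningι 𝒳 (n + 2)).app (W' x ⊓ W' x) (Gh x x)) *
      (thickening 𝒳 (n + 2)).left.presheaf.map (homOfLE i3).op
        ((thickeningι 𝒳 (n + 2)).app (W' x ⊓ W' x) (Gh x x)) =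
      (thickening 𝒳 (n + 2)).left.presheaf.map (homOfLE i3).op
        ((thickeningι 𝒳 (n + 2)).app (W' x ⊓ W' x) (Gh x x)) * 1 := by
    rw [mul_one]; exact h
  have h1 := (hu.map (ConcreteCategory.hom
    ((thickening 𝒳 (n + 2)).left.presheaf.map (homOfLE i3).op))).mul_left_cancel h'
  have h2 : (thickening 𝒳 (n + 2)).left.presheaf.map (homOfLE i3).op
      ((thickeningι 𝒳 (n + 2)).app (W' x ⊓ W' x) (Gh x x) - 1) = 0 := by
    rw [map_sub, map_one, h1, sub_self]
  exact sub_eq_zero.mp (thickening_res_injective_of_ge 𝒳 (n + 2) i3 j3 _ h2)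

end Registered

end

end Summit.HodgeConjecture.HodgeConjecture.Theorems.FormalLiftingFromClassLifting.WeightOne
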